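import Literature.NumberTheory.GaloisRepresentations.ContinuousCorestriction
import Mathlib.GroupTheory.Transfer
import HarnessLib

/-!
# Corestriction on `H¹` with trivial coefficients is the transfer (Verlagerung)

Topic `NumberTheory/GaloisRepresentations`; namespace `Literature.NumberTheory.GaloisRepresentations`.
Theorems only (no definition, no named fact).  `ContinuousCorestriction.lean` constructs, for an open
subgroup `N ≤ G` of finite index and coset representatives `s`, the transfer of a continuous crossed
homomorphism `f` on `N`, `(cor f)(g) = Σ_{x ∈ G/N} s(g•x) • f(s(g•x)⁻¹ g s(x))` (`transferFun`,
`transferCocycle`), and the corestriction `cores : H¹(N, X) → H¹(G, X)` it induces.  When `G` acts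
TRIVIALLY on `X`, a `1`-cocycle on `N` is a continuous homomorphism `f : N → X`, and the transfer of
cochains is literally the group-theoretic transfer: for any homomorphism `φ : N →* Multiplicative X`
agreeing with `f`,

* **`transferFun_eq_toAdd_transfer` — `(cor f)(g) = Ver(φ)(g)`**, `Ver = MonoidHom.transfer`
  (Mathlib; `transfer_def` with the transversal `range s`, `diff` unfolded, the sum reindexed by
  `x ↦ g • x`);
* `transferCocycle_apply_eq_toAdd_transfer`, **`cores_oneCocycleClass_eq_of_trivial`** —
  `cor [f] = [Ver(φ)]` in `H¹(G, X)`, for any continuous cocycle `ψ` of `G` with values `Ver(φ)`;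
  `exists_contOneCocycles_apply_eq_transfer` — such a `ψ` exists (the transfer of a continuous
  character along an open subgroup of finite index is continuous).

This is "`Cor : H¹(N, A) = Hom(N, A) → H¹(G, A) = Hom(G, A)` is composition with the transfer
`Ver : G^ab → N^ab`" (Serre, *Local Fields* VII §8; Neukirch–Schmidt–Wingberg I §5), the degree-one,
trivial-coefficient case of the corestriction, dual to "`Res` on `H₁ = (·)^ab` is the transfer".

Honest framing: classical; nothing here bears on abc or takes a side on [IUTchIII] Cor. 3.12.

## References
* J.-P. Serre, *Local Fields* (1979), VII §7–§8. [SerreLocalFields1979]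
* J. Neukirch, A. Schmidt, K. Wingberg, *Cohomology of Number Fields* (2008), I §5.
-/

noncomputable section

open CategoryTheory Function

universe u v

namespace Literature.NumberTheory.GaloisRepresentations

open Literature.NumberTheory.EllipticCurves (schreierElt schreierElt_coe)
open _root_.ContinuousCohomology

variable {R : Type u} [Ring R] [TopologicalSpace R]
variable {G : Type v} [Group G] [TopologicalSpace G] [IsTopologicalGroup G]
variable (X : TopRep.{v} R G) (N : Subgroup G) [Fintype (G ⧸ N)] {s : G ⧸ N → G}

omit [IsTopologicalGroup G] in
/-- **The transfer of cochains is the group-theoretic transfer for trivial coefficients**: if `G` acts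
trivially on `X`, `f` is a continuous `1`-cocycle (= homomorphism) on `N` and `φ : N →* Multiplicative X`
agrees with `f`, then `(cor_s f)(g) = Ver(φ)(g)` for every `g ∈ G`, `Ver = MonoidHom.transfer φ`.
[cite: SerreLocalFields1979, VII §8] -/
theorem transferFun_eq_toAdd_transfer (htriv : ∀ (g : G) (v : X), X.ρ g v = v)
    (hs : ∀ x : G ⧸ N, (s x : G ⧸ N) = x) (f : contOneCocycles (subgroupRep X N))
    (φ : N →* Multiplicative X) (hφ : ∀ n : N, φ n = Multiplicative.ofAdd (f.1 n)) (g : G) :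
    transferFun X N hs f g =
      Multiplicative.toAdd (haveI : N.FiniteIndex := Subgroup.finiteIndex_of_finite_quotient;
        MonoidHom.transfer φ g) := by
  haveI : N.FiniteIndex := Subgroup.finiteIndex_of_finite_quotient
  set T : N.LeftTransversal := ⟨Set.range s, Subgroup.isComplement_range_left hs⟩ with hT
  have hα : ∀ q : G ⧸ N, (T.2.leftQuotientEquiv q : G) = s q := fun q =>
    Subgroup.IsComplement.leftQuotientEquiv_apply hs q
  have hβ : ∀ q : G ⧸ N, ((g • T).2.leftQuotientEquiv q : G) = g * s (g⁻¹ • q) := fun q => by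
    rw [Subgroup.smul_apply_eq_smul_apply_inv_smul, smul_eq_mul, hα]
  change transferFun X N hs f g = Multiplicative.toAdd (MonoidHom.transfer φ g)
  rw [MonoidHom.transfer_def φ T g]
  simp only [Subgroup.leftTransversals.diff]
  rw [show (N.fintypeQuotientOfFiniteIndex : Fintype (G ⧸ N)) = ‹Fintype (G ⧸ N)› from
    Subsingleton.elim _ _, toAdd_prod, transferFun_apply]
  simp only [htriv]
  refine Fintype.sum_equiv (MulAction.toPerm g) _ _ fun x => ?_
  rw [hφ, toAdd_ofAdd]
  congr 1
  apply Subtype.ext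
  dsimp only
  rw [schreierElt_coe, MulAction.toPerm_apply, hα, hβ, inv_smul_smul, mul_assoc]

/-- `(transferCocycle_s f)(g) = Ver(φ)(g)` (trivial coefficients). [cite: SerreLocalFields1979, VII §8] -/
theorem transferCocycle_apply_eq_toAdd_transfer (htriv : ∀ (g : G) (v : X), X.ρ g v = v)
    (hN : IsOpen (N : Set G)) (hs : ∀ x : G ⧸ N, (s x : G ⧸ N) = x)
    (f : contOneCocycles (subgroupRep X N))
    (φ : N →* Multiplicative X) (hφ : ∀ n : N, φ n = Multiplicative.ofAdd (f.1 n)) (g : G) :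
    (transferCocycle X N hN hs f).1 g =
      Multiplicative.toAdd (haveI : N.FiniteIndex := Subgroup.finiteIndex_of_finite_quotient;
        MonoidHom.transfer φ g) := by
  rw [transferCocycle_apply]
  exact transferFun_eq_toAdd_transfer X N htriv hs f φ hφ g

/-- **The transfer of a continuous character along an open subgroup of finite index is a continuous
character**: there is a continuous `1`-cocycle `ψ` of `G` (trivial coefficients) with
`ψ(g) = Ver(φ)(g)`. [cite: SerreLocalFields1979, VII §8] -/
theorem exists_contOneCocycles_apply_eq_transfer (htriv : ∀ (g : G) (v : X), X.ρ g v = v)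
    (hN : IsOpen (N : Set G)) (f : contOneCocycles (subgroupRep X N))
    (φ : N →* Multiplicative X) (hφ : ∀ n : N, φ n = Multiplicative.ofAdd (f.1 n)) :
    ∃ ψ : contOneCocycles X, ∀ g : G, ψ.1 g =
      Multiplicative.toAdd (haveI : N.FiniteIndex := Subgroup.finiteIndex_of_finite_quotient;
        MonoidHom.transfer φ g) :=
  ⟨transferCocycle X N hN QuotientGroup.out_eq' f,
    transferCocycle_apply_eq_toAdd_transfer X N htriv hN QuotientGroup.out_eq' f φ hφ⟩

/-- **`cor [f] = [Ver(φ)]` in `H¹(G, X)` for trivial coefficients**: the corestriction of the class of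
a continuous homomorphism `f : N → X` is the class of (any continuous cocycle `ψ` with values) the
transfer `Ver(φ) : G → X`, `φ = f` as a homomorphism. [cite: SerreLocalFields1979, VII §8] -/
theorem cores_oneCocycleClass_eq_of_trivial (htriv : ∀ (g : G) (v : X), X.ρ g v = v)
    (hN : IsOpen (N : Set G)) (f : contOneCocycles (subgroupRep X N))
    (φ : N →* Multiplicative X) (hφ : ∀ n : N, φ n = Multiplicative.ofAdd (f.1 n))
    (ψ : contOneCocycles X)
    (hψ : ∀ g : G, ψ.1 g =
      Multiplicative.toAdd (haveI : N.FiniteIndex := Subgroup.finiteIndex_of_finite_quotient;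
        MonoidHom.transfer φ g)) :
    cores X N hN (oneCocycleClass _ f) = oneCocycleClass X ψ := by
  rw [cores_oneCocycleClass X N hN QuotientGroup.out_eq']
  congr 1
  refine Subtype.ext (ContinuousMap.ext fun g => ?_)
  rw [hψ g]
  exact transferCocycle_apply_eq_toAdd_transfer X N htriv hN QuotientGroup.out_eq' f φ hφ g

/-- **`Ver(f|_N) = (G : N) • f` in `H¹(G, X)`** for a continuous homomorphism `f : G → X` (trivial
coefficients): the class of any continuous cocycle with values `Ver(φ)`, `φ = f|_N`, is `(G : N) • [f]`
(`cor ∘ res = (G : N)`). [cite: SerreLocalFields1979, VII §8] -/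
theorem oneCocycleClass_transfer_eq_index_smul (htriv : ∀ (g : G) (v : X), X.ρ g v = v)
    (hN : IsOpen (N : Set G)) (f : contOneCocycles X)
    (φ : N →* Multiplicative X) (hφ : ∀ n : N, φ n = Multiplicative.ofAdd (f.1 n))
    (ψ : contOneCocycles X)
    (hψ : ∀ g : G, ψ.1 g =
      Multiplicative.toAdd (haveI : N.FiniteIndex := Subgroup.finiteIndex_of_finite_quotient;
        MonoidHom.transfer φ g)) :
    oneCocycleClass X ψ = (N.index : R) • oneCocycleClass X f := by
  rw [← cores_resSubgroup X N hN (oneCocycleClass X f), resSubgroup_oneCocycleClass,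
    cores_oneCocycleClass_eq_of_trivial X N htriv hN _ φ (fun n => ?_) ψ hψ]
  rw [hφ, resSubgroup_pullback_apply]

end Literature.NumberTheory.GaloisRepresentations

end
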